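import Summits.ResolutionOfSingularities.ResolutionOfSingularities.Theorems.PurelyInseparableDim4PureLeafKSplitForms
import Summits.ResolutionOfSingularities.ResolutionOfSingularities.Theorems.PurelyInseparableDim4PureLeafFpForms
import HarnessLib
import HarnessLib.Audit.Tags

/-!
# Purely inseparable fourfolds — THE GENERAL FORM `T(R,k)·(N(R,μ) − γ)` of the pure-leaf class over ANY field of characteristic `p`
# (cell res-dim4-pi; D3d kit F_K: kit F `…PureLeafFpForms` with a finite root set `R ⊂ K` in place of `𝔽_p`)
# [OURS · counted 0 · bookkeeping identities of OUR frame, not about resolution]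

Width seat `res-dim4-p-10` (g3).  Over a field `K` of characteristic `p` the states of the pure-leaf class are
`GF(R; k, μ; γ₀) = T(R,k) · (N(R,μ) − C γ₀)` with `T(R,k) = ∏ᵢ ∏_{c∈R} (Xᵢ + C c)^{p·k i c}` (the `p`-th-power part, an `expand p`)
and `N(R,μ) = ∏ᵢ ∏_{c∈R} (Xᵢ + C c)^{μ i c}` (`μ i c < p`, one active root per variable), both supported in the finite root set `R`:

* §1 `powPart_mul_splitForm` (`T·N(μ) = N(p k + μ)`), `gamma_eq_zero_iff` (`γ(R,μ) = ∏ᵢ∏_{c∈R} c^{μ i c} = 0` iff a PURE variable),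
  `generalForm_C_zero`;
* §2 `translate_generalForm` — a `K`-rational translation shifts both exponent arrays onto `R′ = ⋃ᵢ (R + bᵢ)` and keeps `γ₀`;
* §3 `chartTransform_singleton_generalForm` (`k j 0 ↦ k j 0 − 1`);
* §4 `sub_deletePthPowers_splitForm_small`, **`deletePthPowers_generalForm`** — the cleaning only renormalises the constant to `γ(R,μ)`;
* §5 **`step_singleton_generalForm`** — the whole singleton move on `(R; k, μ)`.

Nothing here proves resolution of singularities in dimension ≥ 4 / characteristic `p`; counted 0; AI work, weaker than expert
review. bears_on: LADDER-RESOLUTION:D157-DOOR2 (res-dim4-pi · D3d kit F_K). Supports stmt-ResolutionOfSingularities-16155 (helper).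
-/

set_option linter.dupNamespace false

open MvPolynomial Finset

open scoped BigOperators

noncomputable section

namespace Summit.ResolutionOfSingularities.ResolutionOfSingularities.Theorems.PIDim4

namespace PureLeafK

open Literature.AlgebraicGeometry.Resolution
open Literature.AlgebraicGeometry.Resolution.Hauser2010
open CentreBlowup PthPowerFactor PureLeafNF

variable {σ : Type*} [Fintype σ] [DecidableEq σ] {K : Type*} [Field K] [DecidableEq K] (p : ℕ) [Fact p.Prime] [CharP K p]

/-! ## 1. The general form -/

omit [DecidableEq σ] [DecidableEq K] [Fact p.Prime] [CharP K p] in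
/-- **`T(R,k) · N(R,μ) = N(R, p·k + μ)`.** [folklore] -/
theorem powPart_mul_splitForm (R : Finset K) (k μ : σ → K → ℕ) :
    (∏ i, ∏ c ∈ R, (X i + C c) ^ (p * k i c) : MvPolynomial σ K) * ∏ i, ∏ c ∈ R, (X i + C c) ^ μ i c =
      ∏ i, ∏ c ∈ R, (X i + C c) ^ (p * k i c + μ i c) := by
  rw [← Finset.prod_mul_distrib]
  refine Finset.prod_congr rfl fun i _ => ?_
  rw [← Finset.prod_mul_distrib]
  refine Finset.prod_congr rfl fun c _ => ?_
  rw [pow_add]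

omit [DecidableEq σ] [DecidableEq K] [Fact p.Prime] [CharP K p] in
/-- **`γ(R,μ) = ∏ᵢ ∏_{c∈R} c^{μ i c}` vanishes iff some variable is PURE** (`μ i 0 ≠ 0`; support in `R`). [folklore] -/
theorem gamma_eq_zero_iff (R : Finset K) (μ : σ → K → ℕ) (hS : ∀ i c, c ∉ R → μ i c = 0) :
    (∏ i, ∏ c ∈ R, c ^ μ i c) = 0 ↔ ∃ i, μ i 0 ≠ 0 := by
  constructor
  · intro h
    obtain ⟨i, -, hi⟩ := Finset.prod_eq_zero_iff.mp h
    obtain ⟨c, -, hc⟩ := Finset.prod_eq_zero_iff.mp hi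
    have hne : μ i c ≠ 0 := by rintro h0; rw [h0, pow_zero] at hc; exact one_ne_zero hc
    have hc0 : c = 0 := (pow_eq_zero_iff hne).mp hc
    exact ⟨i, by rw [hc0] at hne; exact hne⟩
  · rintro ⟨i, hi⟩
    have h0 : (0 : K) ∈ R := by by_contra h; exact hi (hS i 0 h)
    exact Finset.prod_eq_zero (Finset.mem_univ i) (Finset.prod_eq_zero h0 (zero_pow hi))

omit [DecidableEq σ] [DecidableEq K] [Fact p.Prime] [CharP K p] in
/-- The PRODUCT case, constant `C 0`: `T(R,k)·(N(R,μ) − C 0) = N(R, p k + μ)`. [folklore] -/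
theorem generalForm_C_zero (R : Finset K) (k μ : σ → K → ℕ) :
    (∏ i, ∏ c ∈ R, (X i + C c) ^ (p * k i c) : MvPolynomial σ K) * ((∏ i, ∏ c ∈ R, (X i + C c) ^ μ i c) - C 0) =
      ∏ i, ∏ c ∈ R, (X i + C c) ^ (p * k i c + μ i c) := by
  rw [C_0, sub_zero, powPart_mul_splitForm]

/-! ## 2. Translations -/

omit [DecidableEq σ] [Fact p.Prime] [CharP K p] in
/-- **Translating the general form**: both arrays are root-shifted onto `R′ = ⋃ᵢ (R + bᵢ)`, the constant is kept. [folklore] -/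
theorem translate_generalForm (b : σ → K) (R : Finset K) (k μ : σ → K → ℕ) (hSk : ∀ i c, c ∉ R → k i c = 0)
    (hSμ : ∀ i c, c ∉ R → μ i c = 0) (γ₀ : K) :
    PointBlowup.translate b ((∏ i, ∏ c ∈ R, (X i + C c) ^ (p * k i c) : MvPolynomial σ K) *
        ((∏ i, ∏ c ∈ R, (X i + C c) ^ μ i c) - C γ₀)) =
      (∏ i, ∏ c ∈ Finset.univ.biUnion (fun i => R.map (addRightEmbedding (b i))), (X i + C c) ^ (p * k i (c - b i)) :
          MvPolynomial σ K) *
        ((∏ i, ∏ c ∈ Finset.univ.biUnion (fun i => R.map (addRightEmbedding (b i))), (X i + C c) ^ μ i (c - b i)) - C γ₀) := by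
  have hC : PointBlowup.translate b (C γ₀ : MvPolynomial σ K) = C γ₀ := by
    unfold PointBlowup.translate; rw [aeval_C, algebraMap_eq]
  have hsub : ∀ P Q : MvPolynomial σ K,
      PointBlowup.translate b (P - Q) = PointBlowup.translate b P - PointBlowup.translate b Q := fun P Q => by
    unfold PointBlowup.translate; rw [map_sub]
  have hSk' : ∀ i c, c ∉ R → (fun i c => p * k i c) i c = 0 := fun i c hc => by
    show p * k i c = 0; rw [hSk i c hc, mul_zero]
  rw [MohAlong.translate_mul, translate_splitForm b R (fun i c => p * k i c) hSk', hsub, translate_splitForm b R μ hSμ, hC]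

/-! ## 3. The singleton chart -/

omit [Fact p.Prime] [CharP K p] in
/-- **The singleton chart on the general form** lowers `k j 0` by one (`1 ≤ k j 0`). [folklore] -/
theorem chartTransform_singleton_generalForm (R : Finset K) (k μ : σ → K → ℕ) (hSk : ∀ i c, c ∉ R → k i c = 0) (γ₀ : K)
    {j : σ} (hj : 1 ≤ k j 0) :
    chartTransform p {j} j ((∏ i, ∏ c ∈ R, (X i + C c) ^ (p * k i c) : MvPolynomial σ K) *
        ((∏ i, ∏ c ∈ R, (X i + C c) ^ μ i c) - C γ₀)) =
      (∏ i, ∏ c ∈ R, (X i + C c) ^ (p * (if i = j ∧ c = 0 then k j 0 - 1 else k i c)) : MvPolynomial σ K) *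
        ((∏ i, ∏ c ∈ R, (X i + C c) ^ μ i c) - C γ₀) := by
  rw [powPart_eq_X_pow_mul p R k hSk hj, mul_assoc, chartTransform_singleton_mul]

/-! ## 4. Cleaning renormalises the constant -/

omit [CharP K p] in
/-- **`N(R,μ) − del N(R,μ) = C γ(R,μ)`** for small single-rooted `μ` supported in `R`. [folklore] -/
theorem sub_deletePthPowers_splitForm_small (R : Finset K) (μ : σ → K → ℕ) (hS : ∀ i c, c ∉ R → μ i c = 0)
    (hμ : ∀ i c, μ i c < p) (h1 : ∀ i c, μ i c ≠ 0 → ∀ c', c' ≠ c → μ i c' = 0) :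
    (∏ i, ∏ c ∈ R, (X i + C c) ^ μ i c : MvPolynomial σ K) - deletePthPowers p (∏ i, ∏ c ∈ R, (X i + C c) ^ μ i c) =
      C (∏ i, ∏ c ∈ R, c ^ μ i c) := by
  have h := sub_deletePthPowers_prod_linearFactors (K := K) p R Finset.univ (fun c : K => c) μ
  rw [h, map_prod]
  refine Finset.prod_congr rfl fun i _ => ?_
  by_cases hex : ∃ c, μ i c ≠ 0
  · obtain ⟨c₀, hc₀⟩ := hex
    have hc₀R : c₀ ∈ R := by by_contra h; exact hc₀ (hS i c₀ h)
    have hfac : (∏ c ∈ R, (X i + C c) ^ μ i c : MvPolynomial σ K) = (X i + C c₀) ^ μ i c₀ := by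
      rw [← Finset.mul_prod_erase R _ hc₀R, Finset.prod_eq_one fun c hc => ?_, mul_one]
      rw [h1 i c₀ hc₀ c (Finset.ne_of_mem_erase hc), pow_zero]
    have hγ : (∏ c ∈ R, c ^ μ i c) = c₀ ^ μ i c₀ := by
      rw [← Finset.mul_prod_erase R _ hc₀R, Finset.prod_eq_one fun c hc => ?_, mul_one]
      rw [h1 i c₀ hc₀ c (Finset.ne_of_mem_erase hc), pow_zero]
    rw [hfac, hγ, sub_deletePthPowers_linearPow p i c₀ (hμ i c₀)]
  · push Not at hex
    have hfac : (∏ c ∈ R, (X i + C c) ^ μ i c : MvPolynomial σ K) = (X i + C 0) ^ (0 : ℕ) := by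
      rw [pow_zero]; exact Finset.prod_eq_one fun c _ => by rw [hex c, pow_zero]
    have hγ : (∏ c ∈ R, c ^ μ i c) = (0 : K) ^ (0 : ℕ) := by
      rw [pow_zero]; exact Finset.prod_eq_one fun c _ => by rw [hex c, pow_zero]
    rw [hfac, hγ, sub_deletePthPowers_linearPow p i 0 (Fact.out : p.Prime).pos]

/-- **THE CLEANING RENORMALISES THE CONSTANT**: for every `γ₀`, `del (T·(N(μ) − C γ₀)) = T·(N(μ) − C γ(R,μ))`. [folklore] -/
theorem deletePthPowers_generalForm (R : Finset K) (k μ : σ → K → ℕ) (γ₀ : K) (hS : ∀ i c, c ∉ R → μ i c = 0)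
    (hμ : ∀ i c, μ i c < p) (h1 : ∀ i c, μ i c ≠ 0 → ∀ c', c' ≠ c → μ i c' = 0) :
    deletePthPowers p ((∏ i, ∏ c ∈ R, (X i + C c) ^ (p * k i c) : MvPolynomial σ K) *
        ((∏ i, ∏ c ∈ R, (X i + C c) ^ μ i c) - C γ₀)) =
      (∏ i, ∏ c ∈ R, (X i + C c) ^ (p * k i c) : MvPolynomial σ K) *
        ((∏ i, ∏ c ∈ R, (X i + C c) ^ μ i c) - C (∏ i, ∏ c ∈ R, c ^ μ i c)) := by
  rw [deletePthPowers_mul_of_forall_dvd p _ _ (forall_dvd_of_mem_support_powPart p R k), deletePthPowers_sub,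
    deletePthPowers_C, sub_zero]
  congr 1
  have h := sub_deletePthPowers_splitForm_small p R μ hS hμ h1
  linear_combination -h

/-! ## 5. The singleton move on the general form -/

/-- **THE SINGLETON MOVE over `K`.** State `F = T(R,k)·(N(R,μ) − C γ₀)` (supports in `R`, `μ` small and single-rooted), centre `{x_j}`
with `1 ≤ k j 0`, ANY `K`-rational reply `b`: the cleaned transform is `T(R′,k₂)·(N(R′,μ₂) − C γ(R′,μ₂))` on the root set
`R′ = ⋃ᵢ (R + bᵢ)` with the root shifts `k₂`, `μ₂` of `k − δ_{(j,0)}`, `μ`. [OURS · counted 0] [folklore] -/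
theorem step_singleton_generalForm (s : CState σ K) (R : Finset K) (k μ : σ → K → ℕ) (γ₀ : K)
    (hF : s.F = (∏ i, ∏ c ∈ R, (X i + C c) ^ (p * k i c) : MvPolynomial σ K) * ((∏ i, ∏ c ∈ R, (X i + C c) ^ μ i c) - C γ₀))
    (hSk : ∀ i c, c ∉ R → k i c = 0) (hSμ : ∀ i c, c ∉ R → μ i c = 0)
    (hμ : ∀ i c, μ i c < p) (h1 : ∀ i c, μ i c ≠ 0 → ∀ c', c' ≠ c → μ i c' = 0) {j : σ} (hj : 1 ≤ k j 0) (b : σ → K) :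
    (step p {j} j b s).F =
      (∏ i, ∏ c ∈ Finset.univ.biUnion (fun i => R.map (addRightEmbedding (b i))),
          (X i + C c) ^ (p * (if i = j ∧ c - b i = 0 then k j 0 - 1 else k i (c - b i))) : MvPolynomial σ K) *
        ((∏ i, ∏ c ∈ Finset.univ.biUnion (fun i => R.map (addRightEmbedding (b i))), (X i + C c) ^ μ i (c - b i)) -
          C (∏ i, ∏ c ∈ Finset.univ.biUnion (fun i => R.map (addRightEmbedding (b i))), c ^ μ i (c - b i))) := by
  have hSk' : ∀ i c, c ∉ R → (if i = j ∧ c = 0 then k j 0 - 1 else k i c) = 0 := fun i c hc => by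
    split_ifs with h
    · rw [h.2] at hc; rw [hSk j 0 hc]
    · exact hSk i c hc
  change deletePthPowers p (PointBlowup.translate b (chartTransform p {j} j s.F)) = _
  have hchart := chartTransform_singleton_generalForm p R k μ hSk γ₀ hj
  have htr := translate_generalForm p b R (fun i c => if i = j ∧ c = 0 then k j 0 - 1 else k i c) μ hSk' hSμ γ₀
  have hdel := deletePthPowers_generalForm p (Finset.univ.biUnion (fun i => R.map (addRightEmbedding (b i))))
    (fun i c => if i = j ∧ c - b i = 0 then k j 0 - 1 else k i (c - b i))
    (fun i c => μ i (c - b i)) γ₀ (support_shift R μ hSμ b) (small_shift hμ b) (singleRoot_shift h1 b)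
  rw [hF, hchart, htr]
  exact hdel

end PureLeafK

end Summit.ResolutionOfSingularities.ResolutionOfSingularities.Theorems.PIDim4

end
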